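import Summits.BirchSwinnertonDyer.BirchSwinnertonDyer.Theorems.ManinLocalTwoThreeEulerRemaindersThirtyTwo
import Summits.BirchSwinnertonDyer.BirchSwinnertonDyer.Theorems.ManinLocalTwoThreeEtaIdentityReductionThirtyTwo
import HarnessLib

/-!
# The `η`-identities of `X₀(32)` and `|c| = 1` on `X₀(32)` — unconditionally

Cell bsd-f2-manin, route `ManinLocalTwoThree` (C2 side: `32 = 2⁵`).  We discharge the three `q`-asymptotics
(T1)₃₂–(T3)₃₂ at `i∞` of `EtaIdentityReductionThirtyTwo.abs_maninConstant_eq_one_thirtyTwo_of_tendsto`: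

  (T1)₃₂ `((2πi)⁻¹X′ + φ₃₂·2Y)/q → 0`,  (T2)₃₂ `((2πi)⁻¹Y′ + φ₃₂(3X² + 4))/q → 0`,  (T3)₃₂ `X³ + 4X − Y² → 0`,

for `X = η(16τ)⁶/(η(8τ)²η(32τ)⁴) = E₁₆⁶/(q²E₈²E₃₂⁴)`, `Y = η(8τ)⁴η(16τ)²/(η(4τ)²η(32τ)⁴) = E₈⁴E₁₆²/(q³E₄²E₃₂⁴)`,
`φ₃₂ = η(4τ)²η(8τ)² = qE₄²E₈²`.  METHOD (as at level 27, `ManinLocalTwoThreeLigozatIdentitiesTwentySeven`): by the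
logarithmic derivatives (`EulerRemaindersThirtyTwo.deriv_X32`, `deriv_Y32`) each target is `G/(q^k · unit)` with
`G` polynomial in `q, E₄, E₈, E₁₆, E₃₂` and their derivatives, `k ∈ {3, 4, 6}`; the remainder calculus
(`ManinLocalTwoThreeQRemainderCalculus`) computes `G` modulo `o(q⁷)` from `E₄ ≡ 1 − q⁴`, `(2πi)⁻¹E₄′ ≡ −4q⁴`,
`E₈ ≡ E₁₆ ≡ E₃₂ ≡ 1`, `E₈′ ≡ E₁₆′ ≡ E₃₂′ ≡ 0 (mod q⁸)`, and each truncation vanishes modulo `X⁸` (`ring`), so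
`G = o(q⁷)`.  CONSEQUENCES: the identities `X′ = −4πiφ₃₂Y`, `Y′ = −2πiφ₃₂(3X² + 4)`, `X³ + 4X = Y²` on `ℍ`
(`X₀(32) → 32a1 : y² = x³ + 4x`); (S2)₃₂ `Λ(φ₃₂) ⊆ Λ(−16, 0)`; and **`|D.maninConstant| = 1` for every globally
minimal `W/ℚ` and every `X₀(32)`-parametrisation datum `D` of `W` with the lattice clause**, with no modularity,
CDT or printed Manin-constant hypothesis (`abs_maninConstant_eq_one_thirtyTwo`), hence `2 ∤ c` there
(`not_two_dvd_maninConstant_thirtyTwo`: the crux `ManinOddAtFour` at `N = 32` without its fact hypotheses).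
BSD is not proved by this; C2/C3 stay open as filed.
-/

set_option autoImplicit false
set_option linter.dupNamespace false

noncomputable section

open Complex Filter Topology Set Asymptotics Polynomial
open UpperHalfPlane hiding I
open scoped Real Topology Manifold MatrixGroups
open Literature.NumberTheory.EllipticCurves Literature.NumberTheory.EllipticCurves.ModularForms

namespace Summit.BirchSwinnertonDyer.BirchSwinnertonDyer.Theorems.ManinLocalTwoThree.LigozatIdentitiesThirtyTwo

open QRemainder EulerRemainders EulerRemaindersThirtyTwo

/-! ## 1. The `q`-asymptotics (T1)₃₂, (T2)₃₂, (T3)₃₂ at `i∞` -/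

/-- **(T3)₃₂**: `X³ + 4X − Y² → 0` at `i∞` (`E₄⁴E₁₆¹⁸ + 4q⁴E₄⁴E₈⁴E₁₆⁶E₃₂⁸ − E₈¹⁴E₁₆⁴E₃₂⁴ ≡ 0 (mod q⁸)`).
[folklore] -/
theorem tendsto_T3 :
    Tendsto (fun τ : ℍ ↦ etaQuotient 32 (expFn [(8, -2), (16, 6), (32, -4)]) τ ^ 3
      + 4 * etaQuotient 32 (expFn [(8, -2), (16, 6), (32, -4)]) τ
      - etaQuotient 32 (expFn [(4, -2), (8, 4), (16, 2), (32, -4)]) τ ^ 2) atImInfty (𝓝 0) := by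
  have hE4 := tendsto_eulerFn_four
  have hE8 := tendsto_eulerFn (δ := 8) (m := 7) (by norm_num)
  have hE16 := tendsto_eulerFn (δ := 16) (m := 7) (by norm_num)
  have hE32 := tendsto_eulerFn (δ := 32) (m := 7) (by norm_num)
  -- `G₃ = E₄⁴E₁₆¹⁸ + 4q⁴(E₄⁴E₈⁴E₁₆⁶E₃₂⁸) − E₈¹⁴E₁₆⁴E₃₂⁴ = o(q⁷)`
  have h1 := QRemainder.mul (QRemainder.pow hE4 4) (QRemainder.pow hE16 18)
  have h2 := QRemainder.const_mul 4 (QRemainder.qParam_pow_mul 4 (QRemainder.mul (QRemainder.mul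
    (QRemainder.mul (QRemainder.pow hE4 4) (QRemainder.pow hE8 4)) (QRemainder.pow hE16 6))
    (QRemainder.pow hE32 8)))
  have h3 := QRemainder.mul (QRemainder.mul (QRemainder.pow hE8 14) (QRemainder.pow hE16 4))
    (QRemainder.pow hE32 4)
  have hG := QRemainder.reduce 0 (-10 + 20 * X ^ 4 - 15 * X ^ 8 + 4 * X ^ 12)
    (by simp only [map_ofNat]; ring) (QRemainder.sub (QRemainder.add h1 h2) h3)
  have hlim := (QRemainder.tendsto_div_pow 6 (by norm_num) hG).mul
    ((((isIntUnitQExp_eulerFn (by norm_num : 0 < 4)).tendsto_one.pow 4).mul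
      (((isIntUnitQExp_eulerFn (by norm_num : 0 < 8)).tendsto_one.pow 6).mul
      ((isIntUnitQExp_eulerFn (by norm_num : 0 < 32)).tendsto_one.pow 12))).inv₀ (by norm_num))
  rw [zero_mul] at hlim
  refine hlim.congr fun τ ↦ ?_
  have hE4' := eulerFn_ne_zero (by norm_num : 0 < 4) τ
  have hE8' := eulerFn_ne_zero (by norm_num : 0 < 8) τ
  have hE32' := eulerFn_ne_zero (by norm_num : 0 < 32) τ
  have hq := qParam_ne_zero τ
  rw [X32_eq, Y32_eq]
  field_simp

/-- **(T1)₃₂**: `((2πi)⁻¹X′ + φ₃₂·2Y)/q → 0` at `i∞`. [folklore] -/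
theorem tendsto_T1 :
    Tendsto (fun τ : ℍ ↦ ((2 * π * I)⁻¹
      * deriv (etaQuotient 32 (expFn [(8, -2), (16, 6), (32, -4)]) ∘ ofComplex) τ
      + cuspFormEtaProductThirtyTwo τ * (2 * etaQuotient 32 (expFn [(4, -2), (8, 4), (16, 2), (32, -4)]) τ))
      / Function.Periodic.qParam 1 (τ : ℂ)) atImInfty (𝓝 0) := by
  have h2pi : (2 * π * I : ℂ) ≠ 0 := by simp [Real.pi_ne_zero, I_ne_zero]
  have hE4 := tendsto_eulerFn_four
  have hE8 := tendsto_eulerFn (δ := 8) (m := 7) (by norm_num)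
  have hE16 := tendsto_eulerFn (δ := 16) (m := 7) (by norm_num)
  have hE32 := tendsto_eulerFn (δ := 32) (m := 7) (by norm_num)
  -- `T_δ = (2πi)⁻¹ E_δ′ = o(q⁷)` for `δ = 8, 16, 32`
  have hT8 := QRemainder.congr_poly (P' := 0) (by rw [mul_zero])
    (QRemainder.const_mul (2 * π * I)⁻¹ (tendsto_deriv_eulerFn (δ := 8) (m := 7) (by norm_num)))
  have hT16 := QRemainder.congr_poly (P' := 0) (by rw [mul_zero])
    (QRemainder.const_mul (2 * π * I)⁻¹ (tendsto_deriv_eulerFn (δ := 16) (m := 7) (by norm_num)))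
  have hT32 := QRemainder.congr_poly (P' := 0) (by rw [mul_zero])
    (QRemainder.const_mul (2 * π * I)⁻¹ (tendsto_deriv_eulerFn (δ := 32) (m := 7) (by norm_num)))
  -- `G₁ = E₁₆⁵(6T₁₆E₈E₃₂ − 2E₁₆E₈E₃₂ − 2E₁₆T₈E₃₂ − 4E₁₆E₈T₃₂) + 2E₈⁹E₁₆²E₃₂ = o(q⁷)`
  have hA := QRemainder.mul (QRemainder.mul (QRemainder.const_mul 6 hT16) hE8) hE32
  have hB := QRemainder.mul (QRemainder.mul (QRemainder.const_mul 2 hE16) hE8) hE32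
  have hC := QRemainder.mul (QRemainder.mul (QRemainder.const_mul 2 hE16) hT8) hE32
  have hD := QRemainder.mul (QRemainder.mul (QRemainder.const_mul 4 hE16) hE8) hT32
  have h1 := QRemainder.mul (QRemainder.pow hE16 5)
    (QRemainder.sub (QRemainder.sub (QRemainder.sub hA hB) hC) hD)
  have h2 := QRemainder.mul (QRemainder.mul (QRemainder.const_mul 2 (QRemainder.pow hE8 9))
    (QRemainder.pow hE16 2)) hE32
  have hG := QRemainder.reduce 0 0 (by simp only [map_ofNat]; ring) (QRemainder.add h1 h2)
  have hlim := (QRemainder.tendsto_div_pow 3 (by norm_num) hG).mul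
    ((((isIntUnitQExp_eulerFn (by norm_num : 0 < 8)).tendsto_one.pow 3).mul
      ((isIntUnitQExp_eulerFn (by norm_num : 0 < 32)).tendsto_one.pow 5)).inv₀ (by norm_num))
  rw [zero_mul] at hlim
  refine hlim.congr fun τ ↦ ?_
  have hE4' := eulerFn_ne_zero (by norm_num : 0 < 4) τ
  have hE8' := eulerFn_ne_zero (by norm_num : 0 < 8) τ
  have hE16' := eulerFn_ne_zero (by norm_num : 0 < 16) τ
  have hE32' := eulerFn_ne_zero (by norm_num : 0 < 32) τ
  have hq := qParam_ne_zero τ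
  rw [deriv_X32, Y32_eq, etaProductThirtyTwo_eq]
  field_simp

/-- **(T2)₃₂**: `((2πi)⁻¹Y′ + φ₃₂(3X² + 4))/q → 0` at `i∞`. [folklore] -/
theorem tendsto_T2 :
    Tendsto (fun τ : ℍ ↦ ((2 * π * I)⁻¹
      * deriv (etaQuotient 32 (expFn [(4, -2), (8, 4), (16, 2), (32, -4)]) ∘ ofComplex) τ
      + cuspFormEtaProductThirtyTwo τ * (3 * etaQuotient 32 (expFn [(8, -2), (16, 6), (32, -4)]) τ ^ 2 + 4))
      / Function.Periodic.qParam 1 (τ : ℂ)) atImInfty (𝓝 0) := by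
  have h2pi : (2 * π * I : ℂ) ≠ 0 := by simp [Real.pi_ne_zero, I_ne_zero]
  have hE4 := tendsto_eulerFn_four
  have hE8 := tendsto_eulerFn (δ := 8) (m := 7) (by norm_num)
  have hE16 := tendsto_eulerFn (δ := 16) (m := 7) (by norm_num)
  have hE32 := tendsto_eulerFn (δ := 32) (m := 7) (by norm_num)
  have hT4 := QRemainder.congr_poly (P' := -4 * X ^ 4)
    (by rw [← mul_assoc, ← map_mul, inv_mul_cancel₀ h2pi, map_one, one_mul])
    (QRemainder.const_mul (2 * π * I)⁻¹ tendsto_deriv_eulerFn_four)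
  have hT8 := QRemainder.congr_poly (P' := 0) (by rw [mul_zero])
    (QRemainder.const_mul (2 * π * I)⁻¹ (tendsto_deriv_eulerFn (δ := 8) (m := 7) (by norm_num)))
  have hT16 := QRemainder.congr_poly (P' := 0) (by rw [mul_zero])
    (QRemainder.const_mul (2 * π * I)⁻¹ (tendsto_deriv_eulerFn (δ := 16) (m := 7) (by norm_num)))
  have hT32 := QRemainder.congr_poly (P' := 0) (by rw [mul_zero])
    (QRemainder.const_mul (2 * π * I)⁻¹ (tendsto_deriv_eulerFn (δ := 32) (m := 7) (by norm_num)))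
  -- `G₂ = E₈⁶E₁₆²E₃₂³(4T₈E₄E₁₆E₃₂ + 2T₁₆E₄E₈E₃₂ − 3E₄E₈E₁₆E₃₂ − 2T₄E₈E₁₆E₃₂ − 4T₃₂E₄E₈E₁₆)`
  -- `      + 3E₄⁵E₈E₁₆¹³ + 4q⁴(E₄⁵E₈⁵E₁₆E₃₂⁸) = o(q⁷)`
  have hA := QRemainder.mul (QRemainder.mul (QRemainder.mul (QRemainder.const_mul 4 hT8) hE4) hE16) hE32
  have hB := QRemainder.mul (QRemainder.mul (QRemainder.mul (QRemainder.const_mul 2 hT16) hE4) hE8) hE32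
  have hC := QRemainder.mul (QRemainder.mul (QRemainder.mul (QRemainder.const_mul 3 hE4) hE8) hE16) hE32
  have hD := QRemainder.mul (QRemainder.mul (QRemainder.mul (QRemainder.const_mul 2 hT4) hE8) hE16) hE32
  have hE := QRemainder.mul (QRemainder.mul (QRemainder.mul (QRemainder.const_mul 4 hT32) hE4) hE8) hE16
  have h1 := QRemainder.mul (QRemainder.mul (QRemainder.mul (QRemainder.pow hE8 6) (QRemainder.pow hE16 2))
    (QRemainder.pow hE32 3))
    (QRemainder.sub (QRemainder.sub (QRemainder.sub (QRemainder.add hA hB) hC) hD) hE)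
  have h2 := QRemainder.mul (QRemainder.mul (QRemainder.const_mul 3 (QRemainder.pow hE4 5)) hE8)
    (QRemainder.pow hE16 13)
  have h3 := QRemainder.const_mul 4 (QRemainder.qParam_pow_mul 4 (QRemainder.mul (QRemainder.mul
    (QRemainder.mul (QRemainder.pow hE4 5) (QRemainder.pow hE8 5)) hE16) (QRemainder.pow hE32 8)))
  have hG := QRemainder.reduce 0 (10 + 10 * X ^ 4 - 25 * X ^ 8 + 17 * X ^ 12 - 4 * X ^ 16)
    (by simp only [map_ofNat]; ring) (QRemainder.add (QRemainder.add h1 h2) h3)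
  have hlim := (QRemainder.tendsto_div_pow 4 (by norm_num) hG).mul
    ((((isIntUnitQExp_eulerFn (by norm_num : 0 < 4)).tendsto_one.pow 3).mul
      ((((isIntUnitQExp_eulerFn (by norm_num : 0 < 8)).tendsto_one.pow 3).mul
      (isIntUnitQExp_eulerFn (by norm_num : 0 < 16)).tendsto_one).mul
      ((isIntUnitQExp_eulerFn (by norm_num : 0 < 32)).tendsto_one.pow 8))).inv₀ (by norm_num))
  rw [zero_mul] at hlim
  refine hlim.congr fun τ ↦ ?_
  have hE4' := eulerFn_ne_zero (by norm_num : 0 < 4) τ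
  have hE8' := eulerFn_ne_zero (by norm_num : 0 < 8) τ
  have hE16' := eulerFn_ne_zero (by norm_num : 0 < 16) τ
  have hE32' := eulerFn_ne_zero (by norm_num : 0 < 32) τ
  have hq := qParam_ne_zero τ
  rw [deriv_Y32, X32_eq, etaProductThirtyTwo_eq]
  field_simp
  ring

/-! ## 2. The identities, (S2)₃₂, and `|c| = 1` on `X₀(32)` — unconditionally -/

/-- **`X′ = −2πi φ₃₂ · 2Y`** on `ℍ`, i.e. `θ(η₁₆⁶η₈⁻²η₃₂⁻⁴) = −2 η₄²η₈⁶η₁₆²η₃₂⁻⁴`. [folklore] -/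
theorem deriv_X (τ : ℍ) :
    deriv (etaQuotient 32 (expFn [(8, -2), (16, 6), (32, -4)]) ∘ ofComplex) τ
      = -(2 * π * I * cuspFormEtaProductThirtyTwo τ)
          * (2 * etaQuotient 32 (expFn [(4, -2), (8, 4), (16, 2), (32, -4)]) τ) :=
  EtaIdentityReductionThirtyTwo.deriv_X_of_tendsto tendsto_T1 τ

/-- **`Y′ = −2πi φ₃₂ · (3X² + 4)`** on `ℍ`. [folklore] -/
theorem deriv_Y (τ : ℍ) :
    deriv (etaQuotient 32 (expFn [(4, -2), (8, 4), (16, 2), (32, -4)]) ∘ ofComplex) τ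
      = -(2 * π * I * cuspFormEtaProductThirtyTwo τ)
          * (3 * etaQuotient 32 (expFn [(8, -2), (16, 6), (32, -4)]) τ ^ 2 + 4) :=
  EtaIdentityReductionThirtyTwo.deriv_Y_of_tendsto tendsto_T2 τ

/-- **The cubic `X³ + 4X = Y²`** on `ℍ`: the `η`-quotients `X = η₁₆⁶/(η₈²η₃₂⁴)`, `Y = η₈⁴η₁₆²/(η₄²η₃₂⁴)`
parametrise `32a1 : y² = x³ + 4x` (a model of `X₀(32)`). [folklore] -/
theorem cubic (τ : ℍ) :
    etaQuotient 32 (expFn [(8, -2), (16, 6), (32, -4)]) τ ^ 3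
      + 4 * etaQuotient 32 (expFn [(8, -2), (16, 6), (32, -4)]) τ
      = etaQuotient 32 (expFn [(4, -2), (8, 4), (16, 2), (32, -4)]) τ ^ 2 :=
  EtaIdentityReductionThirtyTwo.cubic_of_deriv deriv_X deriv_Y tendsto_T3 τ

/-- **(S2)₃₂ unconditionally**: the period lattice of `φ₃₂ = η(4τ)²η(8τ)²` lies in the lattice of the
Weierstrass pair with invariants `g₂ = −16`, `g₃ = 0`. [folklore] -/
theorem periodLatticeLeSquare_thirtyTwo :
    ∃ L₁ : PeriodPair, L₁.g₂ = -16 ∧ L₁.g₃ = 0 ∧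
      ∀ z ∈ periodLattice cuspFormEtaProductThirtyTwo, z ∈ L₁.lattice :=
  EtaIdentityReductionThirtyTwo.periodLatticeLeSquare_of_tendsto tendsto_T1 tendsto_T2 tendsto_T3

/-- **`|c| = 1` on `X₀(32)`, unconditionally**: for every globally minimal `W/ℚ` and every
`X₀(32)`-parametrisation datum `D` of `W` with the lattice clause `Λ_W = c·Λ_f`, `|c| = 1` — no modularity,
CDT or printed Manin-constant fact is assumed. [folklore] -/
theorem abs_maninConstant_eq_one_thirtyTwo (W : WeierstrassCurve ℚ) [W.IsGloballyMinimal]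
    (D : ModularParametrizationData W 32)
    (hopt : ∀ z ∈ D.L.lattice, ∃ w ∈ periodLattice D.f, z = D.c * w) :
    |D.maninConstant| = 1 :=
  EtaIdentityReductionThirtyTwo.abs_maninConstant_eq_one_thirtyTwo_of_tendsto tendsto_T1 tendsto_T2
    tendsto_T3 W D hopt

/-- **`2 ∤ c` on `X₀(32)`, unconditionally** (the shape of the crux `ManinOddAtFour` at the level
`N = 32 = 2⁵`, with none of its four fact hypotheses). [folklore] -/
theorem not_two_dvd_maninConstant_thirtyTwo (W : WeierstrassCurve ℚ) [W.IsGloballyMinimal]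
    (D : ModularParametrizationData W 32)
    (hopt : ∀ z ∈ D.L.lattice, ∃ w ∈ periodLattice D.f, z = D.c * w) :
    ¬ (2 : ℤ) ∣ D.maninConstant :=
  GaussianSqueezeThirtyTwo.not_two_dvd_maninConstant_thirtyTwo_of_le_square
    periodLatticeLeSquare_thirtyTwo W D hopt

end Summit.BirchSwinnertonDyer.BirchSwinnertonDyer.Theorems.ManinLocalTwoThree.LigozatIdentitiesThirtyTwo

end
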